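import Summits.BirchSwinnertonDyer.BirchSwinnertonDyer.Theorems.WildThreeRankOneBSDpOfGlobalDivisibility
import Literature.NumberTheory.EllipticCurves.KolyvaginShaStructureCertificate
import HarnessLib

/-!
# The LOWER receptacle (STEP L at slack `s`) from McCallum's Cor. 5.6 under its PRINTED image hypothesis
# `ρ̄_{E,p}` onto and ONE Kolyvagin certificate — generic odd `p`, ROUTE-FREE
# (cell `pub/bsd-wall`, width seat `bsd-wall-soed-p1-w3` g15, `--supports stmt-BirchSwinnertonDyer-26610`, helper;
# no definition, no named fact minted, no `sorry`)

Mirror of utd-p3's UPPER receptacle `SchneiderFree.Exact.upper_of_globalDivisibility`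
(`WildThreeRankOneBSDpOfGlobalDivisibility.lean` §2) and route-free twin of soed-p1-w3 g5's
`WildSplitEisensteinInclusionAtThreeCertificateRoad.lower_of_certificate` (p59xxxx, which sits in the SOED Theses
cone and carries the `p`-adic TOWER binder `∀ n, ρ̄_{E,p^n}` onto). Since p623399 (this seat) the tree carries
McCallum 1991 Cor. 5.6 (lower, certificate form) under its PRINTED image hypothesis —
`Literature.NumberTheory.EllipticCurves.McCallum1991_pow_dvd_card_sha_primary_of_certificate_modP` (McCallum §5
p. 303 / Thm. 5.4 p. 308: `Gal(ℚ(E_p)/ℚ) = Gl₂(ℤ/pℤ)`, MOD `p`). This file is the one-call door every `p = 3`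
consumer (SOED's E-lineage, RHP's `kolyvagin_split` line, x11b, the `bsd-addord` K1 lanes, UTD's tower columns)
can use to drop its tower / non-tower split:

* `lower_of_certificate_modP` — for `W/ℚ` globally minimal with `ρ̄_{E,p}` onto (`p` odd), `K` imaginary
  quadratic Heegner for `N_E` with `d_K ∉ {−3, −4}`, a datum `(Dt, H, ι)` at level `N_E` and `P ∈ E(K)` with
  `ι(P) = heegnerPointComplex Dt H` of infinite order: Kolyvagin (rank one, `Ш(E/K)` finite; named ∀-fact,
  hypothesis) + the printed-hypothesis McCallum fact (named, hypothesis) + ONE certificate «a square-free `n` of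
  Kolyvagin primes of index `≥ t + s + 1` and a Kolyvagin–Heegner datum `d` of conductor `n` on `(Dt, H.β, ι)`
  with `P_n ∉ p^{t+s+1}E(K[n])`» (`t = ord_p ∏_ℓ c_ℓ(E)`) ⟹ `SchneiderFree.IndexLowerBoundLeAt W p K P s`, i.e.
  `2·ord_p[E(K):ℤP] ≤ ord_p #Ш(E/K) + 2t + 2s`.
* `lower_of_certificate_or_idle_modP` — the same with the idle case `ord_p[E(K):ℤP] ≤ t + s` (no input) folded in.

At `p ≥ 5` nothing changes (Serre: onto mod `p` ⟹ tower); at `p = 3` the 39 onto-3-not-9 (Elkies) classes of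
the W-ALL wild cell join the certificate road. Kernel steps = utd-p3's (non-CM from onto mod `p`; `E(K)[p] = 0`;
the conductor-`1` datum — Darmon Thm. 3.6, tree theorem — with bottom point `P` — Shimura reciprocity, tree
theorem; `p^{M₀} ∥ P`; McCallum Lemma 5.1; `ord_p #Ш = ord_p #Ш[p^∞]`).

HONEST FRAMING: theorems only; every named fact and the certificate are HYPOTHESES; nothing asserted about any
curve; BSD is proved for no curve.

References: [McCallumLMS1991] §4 `S_r(M)` (pp. 299–300), §5 Lemma 5.1 and standing hypotheses (p. 303),
Thm. 5.4 (p. 308), Cor. 5.6 (p. 310); [GrossLMS1991] §4 (4.1), Prop. 6.2, Prop. 9.1; [Kolyvagin1990] Thm. A;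
[Darmon2004] Thm. 3.6–3.7; [WZhang2014] Thm. 1.1, Remark 18; [Elkies2006ThreeAdic] §0.
-/

noncomputable section

open scoped Classical

set_option linter.dupNamespace false -- `Summit.BirchSwinnertonDyer.BirchSwinnertonDyer.Theorems.…` (summit = sub, D-0017)
set_option autoImplicit false

namespace Summit.BirchSwinnertonDyer.BirchSwinnertonDyer.Theorems.KolyvaginCertificateLowerModP

open WeierstrassCurve NumberField IsDedekindDomain Field
  Literature.NumberTheory.EllipticCurves
  Literature.NumberTheory.EllipticCurves.ModularForms
  Literature.NumberTheory.EllipticCurves.Rank1Residual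
  Summit.BirchSwinnertonDyer.Rank1Residual
  Summit.BirchSwinnertonDyer.Rank1Residual.X11b
  Summit.BirchSwinnertonDyer.Rank1Residual.X11b.Three
  Summit.BirchSwinnertonDyer.BirchSwinnertonDyer.Theorems
  Summit.BirchSwinnertonDyer.BirchSwinnertonDyer.Theorems.SchneiderFree.Exact

/-- **THE LOWER RECEPTACLE under McCallum's PRINTED hypothesis — STEP L at slack `s` from ONE level-`(t+s+1)`
certificate, `ρ̄_{E,p}` onto only (no `p`-adic tower).** For `W/ℚ` globally minimal with `ρ̄_{E,p}` onto (`p` odd),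
`K` imaginary quadratic Heegner for `N_E` with `d_K ∉ {−3, −4}`, a datum `(Dt, H, ι)` at level `N_E` and `P ∈ E(K)`
with `ι(P) = heegnerPointComplex Dt H` of infinite order: IF Kolyvagin's theorem holds (`hKo`, named ∀-fact) and
McCallum 1991 Cor. 5.6 holds in its certificate form under the printed image hypothesis (`hMcP`,
`McCallum1991_pow_dvd_card_sha_primary_of_certificate_modP`, named), and there is a square-free `n` all of whose
prime factors are Kolyvagin primes of index `≥ t + s + 1` (`t = ord_p ∏_ℓ c_ℓ(E)`) with a Kolyvagin–Heegner datum
`d` of conductor `n` on `(Dt, H.β, ι)` whose derived point `P_n` is NOT `p^{t+s+1}`-divisible in `E(K[n])`, THEN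
`SchneiderFree.IndexLowerBoundLeAt W p K P s` (`2·ord_p[E(K):ℤP] ≤ ord_p #Ш(E/K) + 2t + 2s`). Every input is an
antecedent; nothing asserted about any curve.
[cite: McCallumLMS1991, §5 Cor. 5.6 (p. 310), Lemma 5.1 and standing hypotheses (p. 303), §4 S_r(M) (pp. 299–300)]
[cite: GrossLMS1991, §4 (4.1)] [cite: Darmon2004, Thm. 3.6–3.7] -/
theorem lower_of_certificate_modP
    (hKo : ∀ (N : ℕ) [NeZero N] (W : WeierstrassCurve ℚ) (K : Type) [Field K] [NumberField K],
      kolyvagin N W K)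
    (hMcP : McCallum1991_pow_dvd_card_sha_primary_of_certificate_modP)
    (W : WeierstrassCurve ℚ) [W.IsElliptic] [W.IsGloballyMinimal] [NeZero (W.conductorNorm ℤ)]
    (p : ℕ) [Fact p.Prime] (hp2 : p ≠ 2) (hsurj : W.HasSurjectiveModNGaloisRep p)
    (K : Type) [Field K] [NumberField K] (hK : IsImaginaryQuadratic K)
    (h3 : NumberField.discr K ≠ -3) (h4 : NumberField.discr K ≠ -4)
    (hHH : SatisfiesHeegnerHypothesis (W.conductorNorm ℤ) K)
    (Dt : ModularParametrizationData W (W.conductorNorm ℤ))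
    (H : HeegnerDatum (W.conductorNorm ℤ) (NumberField.discr K)) (ι : K →+* ℂ)
    (P : (W.baseChange K).toAffine.Point)
    (hP : WeierstrassCurve.Affine.Point.map ι.toRatAlgHom P = heegnerPointComplex Dt H)
    (hnt : ¬ IsOfFinAddOrder P) (s : ℕ) {n : ℕ} (d : KolyvaginHeegnerData Dt H.β ι n) (hn : Squarefree n)
    (hℓ : ∀ ℓ ∈ n.primeFactors, Zhang2014.IsKolyvaginPrime (W.conductorNorm ℤ) W K p ℓ ∧
      padicValNat p W.tamagawaProduct + s + 1 ≤ Zhang2014.kolyvaginIndex W p ℓ)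
    (hcert : ¬ Koly.PDiv d p (padicValNat p W.tamagawaProduct + s + 1)) :
    SchneiderFree.IndexLowerBoundLeAt W p K P s := by
  have hp : p.Prime := Fact.out
  -- mod-`p` image onto, hence irreducible and non-CM
  have hCM : ¬ W.HasCM := fun hCM ↦ W.not_hasSurjectiveModNGaloisRep_of_hasCM hCM hp hp2 hsurj
  haveI : NeZero ((p : ℕ) : ℚ) := ⟨by exact_mod_cast hp.ne_zero⟩
  have hirr : W.HasIrreducibleModPGaloisRep p :=
    hasIrreducibleModPGaloisRep_of_hasSurjectiveModNGaloisRep W p hsurj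
  -- rank one and `Ш(E/K)` finite (Kolyvagin)
  obtain ⟨hrank, hfin⟩ := hKo (W.conductorNorm ℤ) W K hK hHH ⟨Dt, H, ι, hP⟩ hnt
  haveI : Finite (W.baseChange K).sha := hfin
  -- no `p`-torsion in `E(K)`
  have hbot := torsionBy_eq_bot_of_isImaginaryQuadratic_of_hasIrreducibleModPGaloisRep W K hK hp hirr
  have hiv : ∀ x : (W.baseChange K).toAffine.Point, p • x = 0 → x = 0 := fun x hx ↦ by
    have hmem : x ∈ AddSubgroup.torsionBy (W.baseChange K).toAffine.Point ((p : ℕ) : ℤ) := by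
      rw [mem_torsionBy_iff, natCast_zsmul]
      exact hx
    rw [hbot] at hmem
    exact hmem
  -- the conductor-`1` Kolyvagin–Heegner datum on the frame `(Dt, H.β, ι)` (Darmon 2004, Thm. 3.6)
  obtain ⟨d₁⟩ := exists_kolyvaginHeegnerData_one
    (phi_heegnerTau_mem_singularModuliField_holds (W.conductorNorm ℤ) W K) hK Dt H.β ι H.dvd_sq_sub
  -- its bottom point is `P` in `E(K̄)` (Shimura reciprocity at conductor `1`)
  have hPd : d₁.toGeomPoints d₁.derivedPoint = toGeomPoints (W.baseChange K) P :=
    KolyvaginBottom.toGeomPoints_derivedPoint_one_eq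
      (heegnerPointOfConductor_one_galoisConj_holds (W.conductorNorm ℤ) W K) hK hHH hP d₁ rfl
  -- `p^{M₀} ∥ P` (Mordell–Weil)
  haveI : Module.Finite ℤ (W.baseChange K).toAffine.Point := (W.baseChange K).module_finite_point_holds
  obtain ⟨M₀, x₀, hx₀, hmax⟩ := exists_pow_smul_eq_and_forall_ne hnt (p := p) hp.two_le
  have hdiv : ∃ Q : (W.baseChange K).toAffine.Point, ((p ^ M₀ : ℕ) : ℤ) • Q = P :=
    ⟨x₀, by rw [natCast_zsmul]; exact hx₀⟩
  have hndiv : ¬ ∃ Q : (W.baseChange K).toAffine.Point, ((p ^ (M₀ + 1) : ℕ) : ℤ) • Q = P := by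
    rintro ⟨Q, hQ⟩
    exact hmax Q (by rw [← natCast_zsmul]; exact hQ)
  -- McCallum's Cor. 5.6, certificate (lower) form under the PRINTED hypothesis, at level `t + s + 1`
  have hcert' : ¬ ∃ Q : (W.baseChange (ringClassField K ι n)).toAffine.Point,
      ((p ^ (padicValNat p W.tamagawaProduct + s + 1) : ℕ) : ℤ) • Q = d.derivedPoint := hcert
  have hdvd := hMcP W hCM K hK h3 h4 hHH p hp2 hsurj Dt H.β ι d₁ P hPd hnt M₀ hdiv hndiv n
    (padicValNat p W.tamagawaProduct + s) d hn hℓ hcert'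
  have hpos : Nat.card (AddCommGroup.primaryComponent (W.baseChange K).sha p) ≠ 0 := Nat.card_pos.ne'
  have hle : 2 * (M₀ - (padicValNat p W.tamagawaProduct + s)) ≤
      padicValNat p (Nat.card (AddCommGroup.primaryComponent (W.baseChange K).sha p)) :=
    (padicValNat_dvd_iff_le hpos).mp hdvd
  -- `ord_p #Ш = ord_p #Ш[p^∞]` and `ord_p [E(K):ℤP] = M₀`
  have hsha : padicValNat p (W.baseChange K).shaOrder =
      padicValNat p (Nat.card (AddCommGroup.primaryComponent (W.baseChange K).sha p)) :=
    Koly.padicValNat_shaOrder_eq (W.baseChange K) p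
  haveI : Finite (AddCommGroup.torsion (W.baseChange K).toAffine.Point) :=
    WeierstrassCurve.finite_torsion_point (W := W.baseChange K)
  obtain ⟨c, Q, hcQ, hcker⟩ := RankOne.exists_coord_of_mordellWeilRank_eq_one (W.baseChange K) hrank
  have hidx : padicValNat p (AddSubgroup.zmultiples P).index = M₀ :=
    Koly.padicValNat_index_zmultiples_eq_of_divisibility c Q hcQ hcker hiv P hdiv hndiv
  unfold SchneiderFree.IndexLowerBoundLeAt
  rw [hidx, hsha]
  omega

/-- **Both cases in one call**: under the printed-hypothesis McCallum fact and Kolyvagin, STEP L at slack `s`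
holds at the datum as soon as EITHER the index is within budget OR one level-`(t+s+1)` certificate is supplied on
the index-excess side. Every input is an antecedent. [cite: McCallumLMS1991, §5 Cor. 5.6 (p. 310)] -/
theorem lower_of_certificate_or_idle_modP
    (hKo : ∀ (N : ℕ) [NeZero N] (W : WeierstrassCurve ℚ) (K : Type) [Field K] [NumberField K],
      kolyvagin N W K)
    (hMcP : McCallum1991_pow_dvd_card_sha_primary_of_certificate_modP)
    (W : WeierstrassCurve ℚ) [W.IsElliptic] [W.IsGloballyMinimal] [NeZero (W.conductorNorm ℤ)]
    (p : ℕ) [Fact p.Prime] (hp2 : p ≠ 2) (hsurj : W.HasSurjectiveModNGaloisRep p)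
    (K : Type) [Field K] [NumberField K] (hK : IsImaginaryQuadratic K)
    (h3 : NumberField.discr K ≠ -3) (h4 : NumberField.discr K ≠ -4)
    (hHH : SatisfiesHeegnerHypothesis (W.conductorNorm ℤ) K)
    (Dt : ModularParametrizationData W (W.conductorNorm ℤ))
    (H : HeegnerDatum (W.conductorNorm ℤ) (NumberField.discr K)) (ι : K →+* ℂ)
    (P : (W.baseChange K).toAffine.Point)
    (hP : WeierstrassCurve.Affine.Point.map ι.toRatAlgHom P = heegnerPointComplex Dt H)
    (hnt : ¬ IsOfFinAddOrder P) (s : ℕ)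
    (hcert : padicValNat p W.tamagawaProduct + s < padicValNat p (AddSubgroup.zmultiples P).index →
      ∃ (n : ℕ) (d : KolyvaginHeegnerData Dt H.β ι n), Squarefree n ∧
        (∀ ℓ ∈ n.primeFactors, Zhang2014.IsKolyvaginPrime (W.conductorNorm ℤ) W K p ℓ ∧
          padicValNat p W.tamagawaProduct + s + 1 ≤ Zhang2014.kolyvaginIndex W p ℓ) ∧
        ¬ Koly.PDiv d p (padicValNat p W.tamagawaProduct + s + 1)) :
    SchneiderFree.IndexLowerBoundLeAt W p K P s := by
  by_cases hex : padicValNat p W.tamagawaProduct + s < padicValNat p (AddSubgroup.zmultiples P).index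
  · obtain ⟨n, d, hn, hℓ, hc⟩ := hcert hex
    exact lower_of_certificate_modP hKo hMcP W p hp2 hsurj K hK h3 h4 hHH Dt H ι P hP hnt s d hn hℓ hc
  · -- idle case: index within budget (`ord_p #Ш ≥ 0`; = p621234 §0, not importable here route-free)
    unfold SchneiderFree.IndexLowerBoundLeAt
    omega

end Summit.BirchSwinnertonDyer.BirchSwinnertonDyer.Theorems.KolyvaginCertificateLowerModP

end
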